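import Literature.Computability.Cryptography.ChenQuantumLWELineTranslation
import Literature.Computability.Cryptography.ChenQuantumLWEDatumPrivacySharp

/-!
# The chirp basis of a known direction: what an instance-aware observer reads, and what it must know (T18)

REPRODUCTION / ANALYSIS OF A CLAIMED RESULT UNDER ADJUDICATION (withdrawn): Yilei Chen, *Quantum
Algorithms for Lattice Problems*, IACR ePrint 2024/555, version of 2024-04-18 [ChenQuantumLattice2024]
(the version carrying the author's note that Step 9 contains a bug), Step 9 (§3.5.9, pp. 34–38) acting
on the line ket `|φ_{b,v′}⟩ = |φ8.b⟩ = Σ_{j ∈ ℤ_P} ψ_P(−j²) |2D²j·b + v′ mod N⟩` (p. 35), secret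
`b = [−1, 2p₁sᵀ, 2p₁eᵀ]ᵀ` of eq. (12) (p. 17), `P = p₁Q` odd, `N = D²P`.  Bundle
`papers/QuantumAdvantage/lwe-quantum-autopsy/`, Part 2 (`REPAIR-CENSUS.md` §27, theorem **T18**, census
row G7), sequel of `ChenQuantumLWELineTranslation.lean` (T17: DIGIT observers of the register are blind
up to a wrap-around defect) and of `ChenQuantumLWEGeneralMeasurement.lean` (Part 1: certain outcomes of
non-orthogonal states coincide) / `ChenQuantumLWEDatumPrivacySharp.lean` (T12: the POVM of an orthogonal
system).  HONEST FRAMING: kernel-checked THEOREMS about measurements of states occurring in a WITHDRAWN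
algorithm — they settle what the COHERENT instance-aware observers left open by T17 can and cannot do —
NOT summit progress, no cryptanalytic claim in either direction, no new algorithm.

## What is proved

**1. The chirp family of a direction is an orthogonal basis** (`dotProduct_phi8bKet_phi8bKet`,
`chirpKet_orth`).  For odd `P` and `b₀ = −1`, `⟨φ_{b,v′}|φ_{b,w′}⟩ = P·[v′ ≡ w′ (mod N)]`: two offsets on
the same line give a chirp and a proper translate of it (orthogonal by `chirp_autocorrelation`), two
offsets on different lines give disjointly supported kets (`dotProduct_lineKet_lineKet`).  Indexed by the
residue offsets `u ∈ ℤ_N^{n+1}` (`chirpKet b u = |φ_{b, lift u}⟩`) the family has `N^{n+1} = dim` members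
of squared norm `P`: an orthogonal basis, and it RESOLVES every basis ket
(`sum_conj_chirp_smul_chirpKet`, from `sum_conj_chirp_smul_phi8bKet`), so a matrix is determined by its
action on it (`eq_of_mulVec_chirpKet_eq`).

**2. The instance-aware observer reads everything** (`offsetReader`, `offsetReader_certain`,
`POVM.map`, `datumReader_certain`).  The projective measurement in the chirp basis of direction `b`
(`POVM.ofOrthogonal` of T12) outputs, on EVERY `|φ_{b,v′}⟩`, the residue offset `v′ mod N` WITH
CERTAINTY — in particular coordinate `0`, i.e. the datum `v′₀ mod Q` (`toDatum`) AND the Step-8 value,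
i.e. everything Step 9† needs (census O1).  So there is no unconditional no-go for observers that know
the direction `b`: row G7's residual question is only WHAT SUCH AN OBSERVER MUST KNOW.

**3. A certain reader is unique given the direction** (`POVM.effect_eq_of_certain_chirpKet`,
`datumReader_unique`).  If a POVM `E` (any outcome type) is certain of outcome `f u` on `|φ_{b,u}⟩` for
every `u`, then `E_k = P⁻¹ Σ_{u : f u = k} |φ_{b,u}⟩⟨φ_{b,u}|` — its effects are DETERMINED by `b` and
the labelling; for the datum labelling they are those of `datumReader b`.

**4. What the reader must know: the direction class mod `Q`** (`dotProduct_phi8bKet_cross_ne_zero`,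
`not_certain_pair`, `not_certain_both`, `dotProduct_phi8bKet_eq_zero_of_dirCongr`,
`datumReader_certain_of_dirCongr`, `datumReader_certain_iff`).  Let `b, b′` be two directions with
`b₀ = b′₀ = −1` and `2D²p₁` a unit mod `Q`.
(a) If `b_i ≢ b′_i (mod Q)` for some `i`, then `|φ_{b,v′}⟩` and `|φ_{b′, v′ + 2D²(b_i − b′_i)·b}⟩` are
NON-ORTHOGONAL (their lines meet in the points `j′` with `P ∣ 2j′(b − b′)`, where the amplitude product is
the constant `ψ_P((b_i − b′_i)²)`) and carry DIFFERENT data; hence (Part 1's mechanism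
`POVM.eq_of_certain_of_dotProduct_ne_zero`) NO measurement whatsoever is datum-certain on the line kets
of both directions.
(b) If `b ≡ b′ (mod Q)` coordinatewise, then `⟨φ_{b,v′}|φ_{b′,w′}⟩ = 0` whenever the data of `v′, w′`
differ (re-index both lines by `j ↦ j + p₁`: the coincidence pattern is unchanged because
`2D²p₁·b ≡ 2D²p₁·b′ (mod N)`, while the amplitude product turns by `ψ_Q(2·(2D²)⁻¹·Δ) ≠ 1`, `Δ ≠ 0` the
datum difference), so the datum reader of `b` is datum-certain on every `|φ_{b′,w′}⟩` (the offset
reader's effects are the rank-one projectors `P⁻¹|φ_{b,u}⟩⟨φ_{b,u}|`: `spanProj_chirpKet_eq_one`,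
`offsetReader_effect`, `offsetReader_weight`).
(c) Together: **the datum reader of `b` is datum-certain on all line kets of `b′` iff `b ≡ b′ (mod Q)`.**
The instance-aware repair of census row G7 therefore needs exactly the secret's class mod `Q` (at Chen's
sizes, where `|b_i| < Q/2`, the secret itself): "accessing the chirp phases requires the direction mod
`Q`" is now a theorem, and the repair is circular at the summit-relevant threshold (§27 of the census).

`Shape` wrappers under `Shape.Admissible` (`Admissible.isUnit_twoDDp₁_modQ`): `Shape.offsetReader_certain`,
`Shape.datumReader_certain_iff`, `Shape.not_certain_both`.

## What is NOT here

The exact cross-class success profile (the `b`-reader applied to `|φ_{b′,w′}⟩` outputs the right datum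
with probability `gcd(Q, b − b′)/Q`; by hand in the census, §27, with an exact enumeration); near-certain
(approximate) readers; any statement about the COMPLEXITY of implementing `offsetReader b` from the
instance `(U, t)` — by (2)–(4) that is equivalent to computing `b mod Q`, i.e. to the attacked problem,
and carries no claim here.
-/

namespace Literature.Computability.Cryptography.Chen2024

open scoped BigOperators ComplexOrder
open Matrix

/-! ### 0. Coarse-graining a POVM along a function of the outcome -/

namespace POVM

variable {X κ κ' : Type*} [Fintype X] [DecidableEq X] [Fintype κ] [Fintype κ'] [DecidableEq κ']

/-- Post-processing a measurement by a function `f` of its outcome (coarse-graining):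
`E′_k = Σ_{a : f a = k} E_a`. [cite: NielsenChuang2010, §2.2.6 p. 90] -/
noncomputable def map (E : POVM X κ) (f : κ → κ') : POVM X κ' where
  effect k := ∑ a ∈ Finset.univ.filter (fun a => f a = k), E.effect a
  posSemidef k := posSemidef_sum _ fun a _ => E.posSemidef a
  sum_eq_one := by rw [Finset.sum_fiberwise Finset.univ f E.effect, E.sum_eq_one]

/-- The weight of a coarse outcome is the sum of the weights of its fibre.
[cite: NielsenChuang2010, §2.2.6 p. 90] -/
theorem map_weight (E : POVM X κ) (f : κ → κ') (ψ : X → ℂ) (k : κ') :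
    (E.map f).weight ψ k = ∑ a ∈ Finset.univ.filter (fun a => f a = k), E.weight ψ a := by
  unfold weight map
  dsimp only
  rw [Matrix.sum_mulVec, dotProduct_sum]

/-- Coarse-graining preserves certainty: if `a` is certain on `ψ` then `f a` is certain on `ψ` for the
coarse-grained measurement. [cite: NielsenChuang2010, §2.2.6 p. 90] -/
theorem map_certain [DecidableEq κ] (E : POVM X κ) (f : κ → κ') {ψ : X → ℂ} {a : κ}
    (h : E.Certain ψ a) : (E.map f).Certain ψ (f a) := by
  unfold Certain
  rw [map_weight, ← Finset.add_sum_erase (Finset.univ.filter fun a' => f a' = f a)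
    (fun a' => E.weight ψ a') (Finset.mem_filter.2 ⟨Finset.mem_univ a, rfl⟩)]
  rw [Finset.sum_eq_zero, add_zero]
  · exact h
  · intro a' ha'
    unfold weight
    rw [E.mulVec_eq_zero_of_certain h (Finset.mem_erase.1 ha').1, dotProduct_zero]

end POVM

/-! ### 1. Inner products of line kets; the chirp family of a direction is an orthogonal basis -/

/-- The inner product of two line kets is the sum of `conj c_j · d_{j′}` over the pairs of coinciding
points. [folklore] -/
theorem dotProduct_lineKet_lineKet {ι ι' : Type*} [Fintype ι] [Fintype ι'] {k m : ℕ} [NeZero m]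
    (p : ι → (Fin k → ZMod m)) (q : ι' → (Fin k → ZMod m)) (c : ι → ℂ) (d : ι' → ℂ) :
    star (lineKet p c) ⬝ᵥ lineKet q d
      = ∑ j, ∑ j', if p j = q j' then (starRingEnd ℂ) (c j) * d j' else 0 := by
  classical
  have hx : ∀ x : Fin k → ZMod m, star (lineKet p c x) * lineKet q d x
      = ∑ j, ∑ j', if x = p j then (if x = q j' then (starRingEnd ℂ) (c j) * d j' else 0) else 0 := by
    intro x
    unfold lineKet
    rw [Complex.star_def, map_sum, Finset.sum_mul]
    refine Finset.sum_congr rfl fun j _ => ?_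
    rw [Finset.mul_sum]
    refine Finset.sum_congr rfl fun j' _ => ?_
    split_ifs <;> simp [*]
  unfold dotProduct
  simp only [Pi.star_apply, hx]
  rw [Finset.sum_comm]
  refine Finset.sum_congr rfl fun j _ => ?_
  rw [Finset.sum_comm]
  refine Finset.sum_congr rfl fun j' _ => ?_
  rw [Finset.sum_ite_eq' Finset.univ (p j), if_pos (Finset.mem_univ _)]

section ChirpBasis

variable (n : ℕ) (D p₁ Q : ℕ+) (b : Fin (n + 1) → ℤ)

/-- If the lines of direction `b` through `v′` and `w′` share a point, `w′` is `v′` moved along the line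
(`mod N`). [cite: ChenQuantumLattice2024, §3.5.9 p. 35] -/
theorem modEq_lineShift_of_ptB_eq {v' w' : Fin (n + 1) → ℤ} {j₀ j₀' : ZP p₁ Q}
    (h : ptB n D p₁ Q b v' j₀ = ptB n D p₁ Q b w' j₀') (i : Fin (n + 1)) :
    ((w' i : ℤ) : ZN D p₁ Q)
      = ((lineShift n D b v' (((j₀.val : ℕ) : ℤ) - ((j₀'.val : ℕ) : ℤ)) i : ℤ) : ZN D p₁ Q) := by
  have hi := congr_fun h i
  simp only [ptB] at hi
  simp only [lineShift]
  push_cast at hi ⊢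
  linear_combination (-1 : ZN D p₁ Q) * hi

/-- **Inner products in the chirp family of one direction**: `⟨φ_{b,v′}|φ_{b,w′}⟩ = P·[v′ ≡ w′ (mod N)]`
(odd `P`, `b₀ = −1`). [cite: ChenQuantumLattice2024, §3.5.9 p. 35; folklore] -/
theorem dotProduct_phi8bKet_phi8bKet (hP : Odd ((p₁ * Q : ℕ+) : ℕ)) (hb : b 0 = -1)
    (v' w' : Fin (n + 1) → ℤ) :
    star (phi8bKet n D p₁ Q b v') ⬝ᵥ phi8bKet n D p₁ Q b w'
      = if (∀ i, ((v' i : ℤ) : ZN D p₁ Q) = ((w' i : ℤ) : ZN D p₁ Q)) then (((p₁ * Q : ℕ+) : ℕ) : ℂ)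
        else 0 := by
  classical
  have hinj := ptB_injective n D p₁ Q b v' hP hb
  by_cases hmeet : ∃ j₀ j₀' : ZP p₁ Q, ptB n D p₁ Q b v' j₀ = ptB n D p₁ Q b w' j₀'
  · obtain ⟨j₀, j₀', hj⟩ := hmeet
    set t : ℤ := ((j₀.val : ℕ) : ℤ) - ((j₀'.val : ℕ) : ℤ) with ht
    have hw : ∀ i, ((w' i : ℤ) : ZN D p₁ Q) = ((lineShift n D b v' t i : ℤ) : ZN D p₁ Q) :=
      modEq_lineShift_of_ptB_eq n D p₁ Q b hj
    rw [phi8bKet_congr_mod n D p₁ Q b hw, phi8bKet_lineShift]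
    unfold phi8bKet
    rw [dotProduct_lineKet_lineKet]
    simp_rw [hinj.eq_iff, Fintype.sum_ite_eq, sub_eq_neg_add]
    rw [chirp_autocorrelation p₁ Q hP]
    by_cases h0 : ((t : ℤ) : ZP p₁ Q) = 0
    · have hmod : t ≡ 0 [ZMOD (((p₁ * Q : ℕ+) : ℕ) : ℤ)] :=
        (ZMod.intCast_eq_intCast_iff _ _ _).1 (by rw [h0, Int.cast_zero])
      rw [if_pos (neg_eq_zero.mpr h0), if_pos]
      intro i
      rw [hw i, lineShift_cast_eq_of_modEq n D p₁ Q b v' hmod i, lineShift_zero]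
    · rw [if_neg (fun h => h0 (neg_eq_zero.mp h)), if_neg]
      intro hvw
      apply h0
      have hjj : j₀ = j₀' := hinj (by rw [hj, ptB_congr_mod n D p₁ Q b hvw])
      rw [ht, hjj, sub_self, Int.cast_zero]
  · push Not at hmeet
    unfold phi8bKet
    rw [dotProduct_lineKet_lineKet,
      Finset.sum_eq_zero (fun j _ => Finset.sum_eq_zero (fun j' _ => if_neg (hmeet j j'))), if_neg]
    intro hvw
    exact hmeet 0 0 (by rw [ptB_congr_mod n D p₁ Q b hvw])

/-- The line ket of direction `b` through the RESIDUE offset `u ∈ ℤ_N^{n+1}` (the chirp family of `b`,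
indexed without repetition). [cite: ChenQuantumLattice2024, §3.5.9 p. 35] -/
noncomputable def chirpKet (u : Fin (n + 1) → ZN D p₁ Q) : Ket (n + 1) ((D * D * (p₁ * Q) : ℕ+) : ℕ) :=
  phi8bKet n D p₁ Q b (liftV n D p₁ Q u)

/-- Every `|φ_{b,v′}⟩` is the member `v′ mod N` of the chirp family. [folklore] -/
theorem phi8bKet_eq_chirpKet (v' : Fin (n + 1) → ℤ) :
    phi8bKet n D p₁ Q b v' = chirpKet n D p₁ Q b (fun i => ((v' i : ℤ) : ZN D p₁ Q)) :=
  phi8bKet_congr_mod n D p₁ Q b fun i =>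
    (intCast_liftV n D p₁ Q (fun i => ((v' i : ℤ) : ZN D p₁ Q)) i).symm

/-- **The chirp family of a direction is orthogonal**: `⟨φ_{b,u}|φ_{b,u′}⟩ = P·[u = u′]` — `N^{n+1}`
pairwise orthogonal kets of squared norm `P` in dimension `N^{n+1}`: an orthogonal basis of the Step-9
register. [cite: ChenQuantumLattice2024, §3.5.9 p. 35; folklore] -/
theorem chirpKet_orth (hP : Odd ((p₁ * Q : ℕ+) : ℕ)) (hb : b 0 = -1) (u u' : Fin (n + 1) → ZN D p₁ Q) :
    star (chirpKet n D p₁ Q b u) ⬝ᵥ chirpKet n D p₁ Q b u'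
      = if u = u' then (((p₁ * Q : ℕ+) : ℕ) : ℂ) else 0 := by
  unfold chirpKet
  rw [dotProduct_phi8bKet_phi8bKet n D p₁ Q b hP hb]
  simp only [intCast_liftV]
  by_cases h : u = u'
  · rw [if_pos h, if_pos fun i => by rw [h]]
  · rw [if_neg h, if_neg fun h' => h (funext h')]

/-- The same with the squared norm written as a real constant (the form `POVM.ofOrthogonal` wants).
[folklore] -/
theorem chirpKet_orth' (hP : Odd ((p₁ * Q : ℕ+) : ℕ)) (hb : b 0 = -1) (u u' : Fin (n + 1) → ZN D p₁ Q) :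
    star (chirpKet n D p₁ Q b u) ⬝ᵥ chirpKet n D p₁ Q b u'
      = if u = u' then (((((p₁ * Q : ℕ+) : ℕ) : ℝ) : ℂ)) else 0 := by
  rw [Complex.ofReal_natCast]
  exact chirpKet_orth n D p₁ Q b hP hb u u'

/-- **The chirp family resolves the basis kets**: `Σ_t conj ψ_P(−t²)·|φ_{b, y − 2D²t·b}⟩ = P·|y⟩`.
[cite: ChenQuantumLattice2024, §3.5.9 p. 35; folklore] -/
theorem sum_conj_chirp_smul_chirpKet (hP : Odd ((p₁ * Q : ℕ+) : ℕ)) (y : Fin (n + 1) → ZN D p₁ Q) :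
    ∑ t : ZP p₁ Q, (starRingEnd ℂ) (ZMod.stdAddChar (-(t ^ 2) : ZP p₁ Q) : ℂ)
        • chirpKet n D p₁ Q b
            (fun i => ((lineShift n D b (liftV n D p₁ Q y) (-((t.val : ℕ) : ℤ)) i : ℤ) : ZN D p₁ Q))
      = (((p₁ * Q : ℕ+) : ℕ) : ℂ) • Pi.single y (1 : ℂ) := by
  have h := sum_conj_chirp_smul_phi8bKet n D p₁ Q hP b (liftV n D p₁ Q y)
  simp_rw [phi8bKet_eq_chirpKet] at h
  rw [h]
  congr 1
  funext z
  simp only [basisKet, intCast_liftV, Pi.single_apply]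

/-- **A matrix is determined by its action on the chirp family.** [folklore] -/
theorem eq_of_mulVec_chirpKet_eq (hP : Odd ((p₁ * Q : ℕ+) : ℕ))
    {M M' : Matrix (Fin (n + 1) → ZN D p₁ Q) (Fin (n + 1) → ZN D p₁ Q) ℂ}
    (h : ∀ u, M *ᵥ chirpKet n D p₁ Q b u = M' *ᵥ chirpKet n D p₁ Q b u) : M = M' := by
  refine Matrix.ext_of_mulVec_single fun y => ?_
  have hP0 : (((p₁ * Q : ℕ+) : ℕ) : ℂ) ≠ 0 := by exact_mod_cast PNat.ne_zero _
  have key : ∀ L : Matrix (Fin (n + 1) → ZN D p₁ Q) (Fin (n + 1) → ZN D p₁ Q) ℂ,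
      (((p₁ * Q : ℕ+) : ℕ) : ℂ) • (L *ᵥ Pi.single y 1)
        = ∑ t : ZP p₁ Q, (starRingEnd ℂ) (ZMod.stdAddChar (-(t ^ 2) : ZP p₁ Q) : ℂ)
            • (L *ᵥ chirpKet n D p₁ Q b
                (fun i => ((lineShift n D b (liftV n D p₁ Q y) (-((t.val : ℕ) : ℤ)) i : ℤ) : ZN D p₁ Q))) := by
    intro L
    rw [← Matrix.mulVec_smul, ← sum_conj_chirp_smul_chirpKet n D p₁ Q b hP y, Matrix.mulVec_sum]
    simp_rw [Matrix.mulVec_smul]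
  have hM := key M
  simp_rw [h] at hM
  rw [← key M'] at hM
  exact smul_right_injective _ hP0 hM

/-! ### 2. The instance-aware observer: the chirp-basis measurement reads the offset with certainty -/

/-- `P > 0` as a real number. [folklore] -/
theorem P_pos_real : (0 : ℝ) < (((p₁ * Q : ℕ+) : ℕ) : ℝ) := by exact_mod_cast PNat.pos _

/-- **The offset reader of direction `b`**: the projective measurement in the chirp basis of `b`
(outcome = a residue offset `u ∈ ℤ_N^{n+1}`; effects `P⁻¹|φ_{b,u}⟩⟨φ_{b,u}|`, plus the blind share of
the orthogonal complement of the span, which is `0` here). [cite: ChenQuantumLattice2024, §3.5.9 p. 35;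
NielsenChuang2010, §2.2.6 p. 90] -/
noncomputable def offsetReader (hP : Odd ((p₁ * Q : ℕ+) : ℕ)) (hb : b 0 = -1) :
    POVM (Fin (n + 1) → ZN D p₁ Q) (Fin (n + 1) → ZN D p₁ Q) :=
  POVM.ofOrthogonal (chirpKet n D p₁ Q b) (((p₁ * Q : ℕ+) : ℕ) : ℝ) (P_pos_real p₁ Q)
    (chirpKet_orth' n D p₁ Q b hP hb)

/-- **An observer who knows `b` reads the offset `v′ mod N` of `|φ_{b,v′}⟩ WITH CERTAINTY** — every
coordinate, in particular `v′₀ mod N`, hence the datum `v′₀ mod Q` and the Step-8 value: everything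
Step 9† needs. [cite: ChenQuantumLattice2024, §3.5.9 pp. 35–37; NielsenChuang2010, Box 2.3 p. 87] -/
theorem offsetReader_certain (hP : Odd ((p₁ * Q : ℕ+) : ℕ)) (hb : b 0 = -1) (v' : Fin (n + 1) → ℤ) :
    (offsetReader n D p₁ Q b hP hb).Certain (phi8bKet n D p₁ Q b v')
      (fun i => ((v' i : ℤ) : ZN D p₁ Q)) := by
  unfold POVM.Certain offsetReader
  have hal : ∀ a', star (chirpKet n D p₁ Q b a') ⬝ᵥ phi8bKet n D p₁ Q b v'
      = if a' = (fun i => ((v' i : ℤ) : ZN D p₁ Q)) then (((((p₁ * Q : ℕ+) : ℕ) : ℝ) : ℂ)) else 0 := by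
    intro a'
    rw [phi8bKet_eq_chirpKet]
    exact chirpKet_orth' n D p₁ Q b hP hb a' _
  rw [POVM.ofOrthogonal_weight_of_aligned (P_pos_real p₁ Q) (chirpKet_orth' n D p₁ Q b hP hb) hal]
  have hself : star (phi8bKet n D p₁ Q b v') ⬝ᵥ phi8bKet n D p₁ Q b v'
      = (((((p₁ * Q : ℕ+) : ℕ) : ℝ) : ℂ)) := by
    rw [phi8bKet_eq_chirpKet, chirpKet_orth' n D p₁ Q b hP hb, if_pos rfl]
  rw [hself, sub_self, mul_zero, add_zero]

/-- **The datum reader of direction `b`**: measure the chirp basis of `b`, output `u₀ mod Q`.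
[cite: ChenQuantumLattice2024, §3.5.9 pp. 35–37] -/
noncomputable def datumReader (hP : Odd ((p₁ * Q : ℕ+) : ℕ)) (hb : b 0 = -1) :
    POVM (Fin (n + 1) → ZN D p₁ Q) (ZQ Q) :=
  (offsetReader n D p₁ Q b hP hb).map fun u => toDatum D p₁ Q (u 0)

/-- The datum reader of `b` outputs the datum `v′₀ mod Q` of every `|φ_{b,v′}⟩` with certainty.
[cite: ChenQuantumLattice2024, §3.5.9 pp. 35–37] -/
theorem datumReader_certain (hP : Odd ((p₁ * Q : ℕ+) : ℕ)) (hb : b 0 = -1) (v' : Fin (n + 1) → ℤ) :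
    (datumReader n D p₁ Q b hP hb).Certain (phi8bKet n D p₁ Q b v')
      (toDatum D p₁ Q ((v' 0 : ℤ) : ZN D p₁ Q)) := by
  have h := POVM.map_certain (offsetReader n D p₁ Q b hP hb) (fun u => toDatum D p₁ Q (u 0))
    (offsetReader_certain n D p₁ Q b hP hb v')
  exact h

/-! ### 3. A certain reader is unique given the direction -/

/-- **Uniqueness of certain readers.**  If a measurement `E` is certain of the outcome `f u` on every
member `|φ_{b,u}⟩` of the chirp family of `b`, its effects are `E_k = P⁻¹ Σ_{u : f u = k} |φ_{b,u}⟩⟨φ_{b,u}|`.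
[cite: NielsenChuang2010, §2.2.6 p. 90; folklore] -/
theorem POVM.effect_eq_of_certain_chirpKet (hP : Odd ((p₁ * Q : ℕ+) : ℕ)) (hb : b 0 = -1)
    {κ : Type*} [Fintype κ] [DecidableEq κ] (E : POVM (Fin (n + 1) → ZN D p₁ Q) κ)
    (f : (Fin (n + 1) → ZN D p₁ Q) → κ) (hE : ∀ u, E.Certain (chirpKet n D p₁ Q b u) (f u)) (k : κ) :
    E.effect k = ∑ u ∈ Finset.univ.filter (fun u => f u = k),
        ((((p₁ * Q : ℕ+) : ℕ) : ℂ))⁻¹ • vecMulVec (chirpKet n D p₁ Q b u) (star (chirpKet n D p₁ Q b u)) := by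
  have hP0 : (((p₁ * Q : ℕ+) : ℕ) : ℂ) ≠ 0 := by exact_mod_cast PNat.ne_zero _
  refine eq_of_mulVec_chirpKet_eq n D p₁ Q b hP fun u' => ?_
  have hl : E.effect k *ᵥ chirpKet n D p₁ Q b u'
      = if f u' = k then chirpKet n D p₁ Q b u' else 0 := by
    split_ifs with hk
    · rw [← hk]
      exact E.mulVec_eq_self_of_certain (hE u')
    · exact E.mulVec_eq_zero_of_certain (hE u') (fun h => hk h.symm)
  have hs : ∀ u, (((((p₁ * Q : ℕ+) : ℕ) : ℂ))⁻¹
        • vecMulVec (chirpKet n D p₁ Q b u) (star (chirpKet n D p₁ Q b u))) *ᵥ chirpKet n D p₁ Q b u'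
      = if u = u' then chirpKet n D p₁ Q b u else 0 := by
    intro u
    rw [Matrix.smul_mulVec, vecMulVec_star_mulVec, chirpKet_orth n D p₁ Q b hP hb]
    split_ifs with hu
    · rw [smul_smul, inv_mul_cancel₀ hP0, one_smul]
    · rw [zero_smul, smul_zero]
  rw [hl, Matrix.sum_mulVec]
  simp_rw [hs]
  rw [Finset.sum_ite_eq' (Finset.univ.filter fun u => f u = k) u' (fun u => chirpKet n D p₁ Q b u)]
  simp only [Finset.mem_filter, Finset.mem_univ, true_and]

/-- In particular a measurement that is datum-certain on every `|φ_{b,v′}⟩` has the effects of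
`datumReader b`: `P⁻¹ Σ_{u : u₀ ≡ a (mod Q)} |φ_{b,u}⟩⟨φ_{b,u}|`. [folklore] -/
theorem datumReader_unique (hP : Odd ((p₁ * Q : ℕ+) : ℕ)) (hb : b 0 = -1)
    (E : POVM (Fin (n + 1) → ZN D p₁ Q) (ZQ Q))
    (hE : ∀ v' : Fin (n + 1) → ℤ, E.Certain (phi8bKet n D p₁ Q b v') (toDatum D p₁ Q ((v' 0 : ℤ) : ZN D p₁ Q)))
    (a : ZQ Q) :
    E.effect a = (datumReader n D p₁ Q b hP hb).effect a := by
  have h1 : ∀ F : POVM (Fin (n + 1) → ZN D p₁ Q) (ZQ Q),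
      (∀ v' : Fin (n + 1) → ℤ, F.Certain (phi8bKet n D p₁ Q b v') (toDatum D p₁ Q ((v' 0 : ℤ) : ZN D p₁ Q)))
        → F.effect a = ∑ u ∈ Finset.univ.filter (fun u => toDatum D p₁ Q (u 0) = a),
            ((((p₁ * Q : ℕ+) : ℕ) : ℂ))⁻¹
              • vecMulVec (chirpKet n D p₁ Q b u) (star (chirpKet n D p₁ Q b u)) := by
    intro F hF
    refine POVM.effect_eq_of_certain_chirpKet n D p₁ Q b hP hb F (fun u => toDatum D p₁ Q (u 0)) ?_ a
    intro u
    have := hF (liftV n D p₁ Q u)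
    simp only [intCast_liftV] at this
    exact this
  rw [h1 E hE, h1 _ (datumReader_certain n D p₁ Q b hP hb)]

/-! ### 4. What a certain reader must know: the direction class mod `Q` -/

/-- `2D²` is a unit mod `Q` when `2D²p₁` is. [folklore] -/
theorem isUnit_twoDD_modQ (hunit : IsUnit ((2 * D * D * p₁ : ℕ) : ZQ Q)) :
    IsUnit ((2 * D * D : ℕ) : ZQ Q) := by
  rw [Nat.cast_mul] at hunit
  exact isUnit_of_mul_isUnit_left hunit

/-- Divisibility transfer `N = D²P`, `P` odd: `2D²x ≡ 0 (mod N) ⇒ x ≡ 0 (mod P)`. [folklore] -/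
theorem intCast_ZP_eq_zero_of_twoDsq_mul (hP : Odd ((p₁ * Q : ℕ+) : ℕ)) {x : ℤ}
    (h : ((2 * ((D : ℕ) : ℤ) ^ 2 * x : ℤ) : ZN D p₁ Q) = 0) : ((x : ℤ) : ZP p₁ Q) = 0 := by
  rw [ZMod.intCast_zmod_eq_zero_iff_dvd] at h ⊢
  have hD : ((D : ℕ) : ℤ) * ((D : ℕ) : ℤ) ≠ 0 := by positivity
  have e1 : (((D * D * (p₁ * Q) : ℕ+) : ℕ) : ℤ)
      = ((D : ℕ) : ℤ) * ((D : ℕ) : ℤ) * (((p₁ * Q : ℕ+) : ℕ) : ℤ) := by push_cast; ring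
  have e2 : (2 * ((D : ℕ) : ℤ) ^ 2 * x : ℤ) = ((D : ℕ) : ℤ) * ((D : ℕ) : ℤ) * (2 * x) := by ring
  rw [e1, e2] at h
  have h1 : (((p₁ * Q : ℕ+) : ℕ) : ℤ) ∣ 2 * x := (mul_dvd_mul_iff_left hD).1 h
  have hcop : IsCoprime (((p₁ * Q : ℕ+) : ℕ) : ℤ) 2 := by
    have := Nat.isCoprime_iff_coprime.2 (Nat.coprime_two_right.2 hP)
    simpa using this
  exact hcop.dvd_of_dvd_mul_left h1

/-- The point of parameter `c` on the line `(b, v′)` is the offset of the line `(b′, v′ + 2D²c·b)`.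
[cite: ChenQuantumLattice2024, §3.5.9 p. 35] -/
theorem ptB_intCast_eq_ptB_lineShift_zero (b' v' : Fin (n + 1) → ℤ) (c : ℤ) :
    ptB n D p₁ Q b v' ((c : ℤ) : ZP p₁ Q) = ptB n D p₁ Q b' (lineShift n D b v' c) 0 := by
  rw [ptB_intCast, ptB_zero]
  funext i
  simp only [Pi.add_apply, dirStep, lineShift, Int.cast_add]

/-- **Where two lines of different directions meet.**  If `b₀ = b′₀ = −1` and the line `(b, v′)` meets
the line `(b′, v′ + 2D²c·b)` at parameters `j, j′`, then `j = j′ + c` and `2D²j′(b − b′) ≡ 0 (mod N)`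
coordinatewise. [cite: ChenQuantumLattice2024, §3.5.9 p. 35; folklore] -/
theorem ptB_eq_ptB_lineShift (hP : Odd ((p₁ * Q : ℕ+) : ℕ)) (hb : b 0 = -1)
    (b' : Fin (n + 1) → ℤ) (hb' : b' 0 = -1) (v' : Fin (n + 1) → ℤ) (c : ℤ) {j j' : ZP p₁ Q}
    (h : ptB n D p₁ Q b v' j = ptB n D p₁ Q b' (lineShift n D b v' c) j') :
    j = j' + ((c : ℤ) : ZP p₁ Q)
      ∧ ∀ i, ((2 * ((D : ℕ) : ℤ) ^ 2 * ((j'.val : ℕ) : ℤ) * (b i - b' i) : ℤ) : ZN D p₁ Q) = 0 := by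
  have h0 := congr_fun h 0
  simp only [ptB, lineShift, hb, hb'] at h0
  have hx : ((2 * ((D : ℕ) : ℤ) ^ 2 * (((j'.val : ℕ) : ℤ) + c - ((j.val : ℕ) : ℤ)) : ℤ) : ZN D p₁ Q)
      = 0 := by
    push_cast at h0 ⊢
    linear_combination h0
  have hj : j = j' + ((c : ℤ) : ZP p₁ Q) := by
    have h1 := intCast_ZP_eq_zero_of_twoDsq_mul D p₁ Q hP hx
    simp only [Int.cast_sub, Int.cast_add, Int.cast_natCast, ZMod.natCast_zmod_val] at h1
    linear_combination -h1
  refine ⟨hj, fun i => ?_⟩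
  have hi := congr_fun h i
  simp only [ptB, lineShift] at hi
  have hmod : ((j.val : ℕ) : ℤ) ≡ ((j'.val : ℕ) : ℤ) + c [ZMOD (((p₁ * Q : ℕ+) : ℕ) : ℤ)] := by
    refine (ZMod.intCast_eq_intCast_iff _ _ _).1 ?_
    simp only [Int.cast_add, Int.cast_natCast, ZMod.natCast_zmod_val]
    exact hj
  have e := twoDsq_mul_eq_of_modEq D p₁ Q (b i) hmod
  push_cast at hi e ⊢
  linear_combination hi - e

/-- **Line kets of different direction classes mod `Q` are not orthogonal.**  If `b₀ = b′₀ = −1` then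
`⟨φ_{b,v′} | φ_{b′, v′ + 2D²(b_i − b′_i)·b}⟩ ≠ 0`: the two lines meet (at parameter `c = b_i − b′_i`
resp. `0`), and at every common point the amplitude product is the constant `ψ_P(c²)`.
[cite: ChenQuantumLattice2024, §3.5.9 p. 35; folklore] -/
theorem dotProduct_phi8bKet_cross_ne_zero (hP : Odd ((p₁ * Q : ℕ+) : ℕ)) (hb : b 0 = -1)
    (b' : Fin (n + 1) → ℤ) (hb' : b' 0 = -1) (v' : Fin (n + 1) → ℤ) (i : Fin (n + 1)) :
    star (phi8bKet n D p₁ Q b v') ⬝ᵥ phi8bKet n D p₁ Q b' (lineShift n D b v' (b i - b' i)) ≠ 0 := by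
  classical
  have hinj := ptB_injective n D p₁ Q b v' hP hb
  have hinj' := ptB_injective n D p₁ Q b' (lineShift n D b v' (b i - b' i)) hP hb'
  refine dotProduct_ne_zero_of_rigid _ _
    (stdAddChar_ne_zero ((((b i - b' i : ℤ) : ZP p₁ Q)) ^ 2)) ?_ ?_
  · intro z hz hz'
    obtain ⟨j, rfl⟩ : ∃ j, z = ptB n D p₁ Q b v' j := by
      by_contra hcon
      push Not at hcon
      exact hz (by unfold phi8bKet; exact lineKet_apply_of_ne _ _ hcon)
    obtain ⟨j', hj'⟩ :
        ∃ j', ptB n D p₁ Q b v' j = ptB n D p₁ Q b' (lineShift n D b v' (b i - b' i)) j' := by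
      by_contra hcon
      push Not at hcon
      exact hz' (by unfold phi8bKet; exact lineKet_apply_of_ne _ _ hcon)
    obtain ⟨hjj, hzero⟩ := ptB_eq_ptB_lineShift n D p₁ Q b hP hb b' hb' v' (b i - b' i) hj'
    have hψ : phi8bKet n D p₁ Q b v' (ptB n D p₁ Q b v' j)
        = (ZMod.stdAddChar (-(j ^ 2) : ZP p₁ Q) : ℂ) := by
      unfold phi8bKet; exact lineKet_apply_pt hinj _ j
    have hφ : phi8bKet n D p₁ Q b' (lineShift n D b v' (b i - b' i)) (ptB n D p₁ Q b v' j)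
        = (ZMod.stdAddChar (-(j' ^ 2) : ZP p₁ Q) : ℂ) := by
      rw [hj']; unfold phi8bKet; exact lineKet_apply_pt hinj' _ j'
    have hjc : j' * ((b i - b' i : ℤ) : ZP p₁ Q) = 0 := by
      have h2 : ((2 * ((D : ℕ) : ℤ) ^ 2 * (((j'.val : ℕ) : ℤ) * (b i - b' i)) : ℤ) : ZN D p₁ Q)
          = 0 := by
        rw [← hzero i]; push_cast; ring
      have h3 := intCast_ZP_eq_zero_of_twoDsq_mul D p₁ Q hP h2
      simpa only [Int.cast_mul, Int.cast_natCast, ZMod.natCast_zmod_val] using h3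
    rw [hψ, hφ, ← AddChar.map_neg_eq_conj, ← AddChar.map_add_eq_mul]
    congr 1
    rw [hjj]
    linear_combination (2 : ZP p₁ Q) * hjc
  · refine ⟨ptB n D p₁ Q b v' (((b i - b' i : ℤ)) : ZP p₁ Q), ?_, ?_⟩
    · unfold phi8bKet
      rw [lineKet_apply_pt hinj]
      exact stdAddChar_ne_zero _
    · rw [ptB_intCast_eq_ptB_lineShift_zero n D p₁ Q b b' v']
      unfold phi8bKet
      rw [lineKet_apply_pt hinj']
      exact stdAddChar_ne_zero _

/-- The datum of the shifted offset `v′ + 2D²c·b` is `datum(v′) − 2D²c (mod Q)` (`b₀ = −1`).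
[cite: ChenQuantumLattice2024, §3.5.9 p. 37] -/
theorem toDatum_lineShift (hb : b 0 = -1) (v' : Fin (n + 1) → ℤ) (c : ℤ) :
    toDatum D p₁ Q ((lineShift n D b v' c 0 : ℤ) : ZN D p₁ Q)
      = toDatum D p₁ Q ((v' 0 : ℤ) : ZN D p₁ Q) - ((2 * D * D : ℕ) : ZQ Q) * ((c : ℤ) : ZQ Q) := by
  simp only [toDatum_intCast, lineShift, hb]
  push_cast
  ring

/-- **No measurement is datum-certain across direction classes.**  If `b_i ≢ b′_i (mod Q)` (heads
`−1`, `2D²p₁` a unit mod `Q`), no POVM outputs the datum with certainty on both `|φ_{b,v′}⟩` and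
`|φ_{b′, v′ + 2D²(b_i − b′_i)·b}⟩` — the two are non-orthogonal with different data (Part 1's
`POVM.eq_of_certain_of_dotProduct_ne_zero`). [cite: ChenQuantumLattice2024, §3.5.9 pp. 35–37;
NielsenChuang2010, Box 2.3 p. 87] -/
theorem not_certain_pair (hP : Odd ((p₁ * Q : ℕ+) : ℕ)) (hb : b 0 = -1)
    (b' : Fin (n + 1) → ℤ) (hb' : b' 0 = -1) (hunit : IsUnit ((2 * D * D * p₁ : ℕ) : ZQ Q))
    {i : Fin (n + 1)} (hi : ((b i : ℤ) : ZQ Q) ≠ ((b' i : ℤ) : ZQ Q))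
    (E : POVM (Fin (n + 1) → ZN D p₁ Q) (ZQ Q)) (v' : Fin (n + 1) → ℤ) :
    ¬ (E.Certain (phi8bKet n D p₁ Q b v') (toDatum D p₁ Q ((v' 0 : ℤ) : ZN D p₁ Q))
        ∧ E.Certain (phi8bKet n D p₁ Q b' (lineShift n D b v' (b i - b' i)))
            (toDatum D p₁ Q ((lineShift n D b v' (b i - b' i) 0 : ℤ) : ZN D p₁ Q))) := by
  classical
  rintro ⟨h1, h2⟩
  have heq := E.eq_of_certain_of_dotProduct_ne_zero h1 h2
    (dotProduct_phi8bKet_cross_ne_zero n D p₁ Q b hP hb b' hb' v' i)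
  rw [toDatum_lineShift n D p₁ Q b hb v' (b i - b' i)] at heq
  have hc : ((b i - b' i : ℤ) : ZQ Q) ≠ 0 := by rwa [Int.cast_sub, sub_ne_zero]
  apply hc
  have h0 : ((2 * D * D : ℕ) : ZQ Q) * ((b i - b' i : ℤ) : ZQ Q) = 0 := by
    linear_combination heq
  exact ((isUnit_twoDD_modQ D p₁ Q hunit).mul_right_eq_zero).1 h0

/-- Hence no measurement is datum-certain on ALL line kets of two directions in different classes
mod `Q`. [cite: ChenQuantumLattice2024, §3.5.9 pp. 35–37] -/
theorem not_certain_both (hP : Odd ((p₁ * Q : ℕ+) : ℕ)) (hb : b 0 = -1)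
    (b' : Fin (n + 1) → ℤ) (hb' : b' 0 = -1) (hunit : IsUnit ((2 * D * D * p₁ : ℕ) : ZQ Q))
    {i : Fin (n + 1)} (hi : ((b i : ℤ) : ZQ Q) ≠ ((b' i : ℤ) : ZQ Q))
    (E : POVM (Fin (n + 1) → ZN D p₁ Q) (ZQ Q)) :
    ¬ ((∀ v' : Fin (n + 1) → ℤ,
          E.Certain (phi8bKet n D p₁ Q b v') (toDatum D p₁ Q ((v' 0 : ℤ) : ZN D p₁ Q)))
        ∧ ∀ w' : Fin (n + 1) → ℤ,
          E.Certain (phi8bKet n D p₁ Q b' w') (toDatum D p₁ Q ((w' 0 : ℤ) : ZN D p₁ Q))) :=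
  fun h => not_certain_pair n D p₁ Q b hP hb b' hb' hunit hi E 0 ⟨h.1 0, h.2 _⟩

/-- Moving `p₁` steps along a line adds the class-invariant step `2D²p₁·b (mod N)`.
[cite: ChenQuantumLattice2024, §3.5.9 p. 35] -/
theorem ptB_add_p₁ (v' : Fin (n + 1) → ℤ) (j : ZP p₁ Q) :
    ptB n D p₁ Q b v' (j + ((p₁ : ℕ) : ZP p₁ Q))
      = ptB n D p₁ Q b v' j + dirStep n D p₁ Q ((p₁ : ℕ) : ℤ) b := by
  have e : j + ((p₁ : ℕ) : ZP p₁ Q) = ((((j.val : ℕ) : ℤ) + ((p₁ : ℕ) : ℤ) : ℤ) : ZP p₁ Q) := by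
    rw [Int.cast_add, Int.cast_natCast, Int.cast_natCast, ZMod.natCast_zmod_val]
  have hj : ptB n D p₁ Q b v' j = ptB n D p₁ Q b v' ((((j.val : ℕ) : ℤ) : ℤ) : ZP p₁ Q) := by
    rw [Int.cast_natCast, ZMod.natCast_zmod_val]
  rw [e, hj, ptB_intCast, ptB_intCast]
  funext i
  simp only [Pi.add_apply, dirStep]
  push_cast
  ring

/-- The step `2D²p₁·b (mod N)` depends on `b mod Q` only. [folklore] -/
theorem dirStep_p₁_eq_of_dirCongr (b' : Fin (n + 1) → ℤ)
    (hbb' : ∀ k, ((b k : ℤ) : ZQ Q) = ((b' k : ℤ) : ZQ Q)) :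
    dirStep n D p₁ Q ((p₁ : ℕ) : ℤ) b = dirStep n D p₁ Q ((p₁ : ℕ) : ℤ) b' := by
  funext i
  have hmod : b i ≡ b' i [ZMOD (((Q : ℕ+) : ℕ) : ℤ)] := (ZMod.intCast_eq_intCast_iff _ _ _).1 (hbb' i)
  have e := Dsq_p₁_mul_eq_of_modEq D p₁ Q hmod
  simp only [dirStep]
  have e2 : ∀ x : ℤ, ((2 * ((D : ℕ) : ℤ) ^ 2 * ((p₁ : ℕ) : ℤ) * x : ℤ) : ZN D p₁ Q)
      = 2 * ((((D : ℕ) : ℤ) ^ 2 * ((p₁ : ℕ) : ℤ) * x : ℤ) : ZN D p₁ Q) := by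
    intro x; push_cast; ring
  rw [e2, e2, e]

/-- `Q` is odd when `P = p₁Q` is. [folklore] -/
theorem odd_Q_of_odd_P (hP : Odd ((p₁ * Q : ℕ+) : ℕ)) : Odd ((Q : ℕ+) : ℕ) := by
  rw [PNat.mul_coe] at hP
  exact Nat.Odd.of_mul_right hP

/-- **Line kets of the same direction class mod `Q` with different data are orthogonal.**  If
`b ≡ b′ (mod Q)` coordinatewise (heads `−1`, `2D²p₁` a unit mod `Q`) and the data of `v′, w′` differ,
then `⟨φ_{b,v′}|φ_{b′,w′}⟩ = 0`: re-indexing both lines by `p₁` steps preserves the coincidence pattern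
and turns the amplitude product by `ψ_Q(2·(2D²)⁻¹·Δdatum) ≠ 1`.
[cite: ChenQuantumLattice2024, §3.5.9 pp. 35–37; folklore] -/
theorem dotProduct_phi8bKet_eq_zero_of_dirCongr (hP : Odd ((p₁ * Q : ℕ+) : ℕ)) (hb : b 0 = -1)
    (b' : Fin (n + 1) → ℤ) (hb' : b' 0 = -1) (hunit : IsUnit ((2 * D * D * p₁ : ℕ) : ZQ Q))
    (hbb' : ∀ k, ((b k : ℤ) : ZQ Q) = ((b' k : ℤ) : ZQ Q)) {v' w' : Fin (n + 1) → ℤ}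
    (hne : toDatum D p₁ Q ((v' 0 : ℤ) : ZN D p₁ Q) ≠ toDatum D p₁ Q ((w' 0 : ℤ) : ZN D p₁ Q)) :
    star (phi8bKet n D p₁ Q b v') ⬝ᵥ phi8bKet n D p₁ Q b' w' = 0 := by
  classical
  obtain ⟨u2, hu2⟩ := isUnit_twoDD_modQ D p₁ Q hunit
  set Δ : ZQ Q := toDatum D p₁ Q ((v' 0 : ℤ) : ZN D p₁ Q) - toDatum D p₁ Q ((w' 0 : ℤ) : ZN D p₁ Q)
    with hΔ
  have hΔ0 : Δ ≠ 0 := sub_ne_zero.2 hne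
  set ζ : ℂ := (ZMod.stdAddChar ((2 : ZQ Q) * (((u2⁻¹ : (ZQ Q)ˣ) : ZQ Q) * Δ)) : ℂ) with hζ
  have hζ1 : ζ ≠ 1 := by
    intro h1
    have h2 : (ZMod.stdAddChar ((2 : ZQ Q) * (((u2⁻¹ : (ZQ Q)ˣ) : ZQ Q) * Δ)) : ℂ)
        = ZMod.stdAddChar (0 : ZQ Q) := by
      rw [← hζ, h1, AddChar.map_zero_eq_one]
    have h3 := stdAddChar_injective h2
    have htwo : IsUnit (2 : ZQ Q) :=
      Literature.NumberTheory.GaussSums.isUnit_two_zmod_of_odd _ (odd_Q_of_odd_P p₁ Q hP)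
    rw [htwo.mul_right_eq_zero, (Units.isUnit u2⁻¹).mul_right_eq_zero] at h3
    exact hΔ0 h3
  -- the double-sum form of the inner product and its invariance under the `p₁`-shift
  set p : ZP p₁ Q := ((p₁ : ℕ) : ZP p₁ Q) with hp
  set F : ZP p₁ Q → ZP p₁ Q → ℂ := fun j j' =>
    if ptB n D p₁ Q b v' j = ptB n D p₁ Q b' w' j' then
      (starRingEnd ℂ) (ZMod.stdAddChar (-(j ^ 2) : ZP p₁ Q) : ℂ)
        * (ZMod.stdAddChar (-(j' ^ 2) : ZP p₁ Q) : ℂ)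
    else 0 with hF
  have hS : star (phi8bKet n D p₁ Q b v') ⬝ᵥ phi8bKet n D p₁ Q b' w' = ∑ j, ∑ j', F j j' := by
    unfold phi8bKet; rw [dotProduct_lineKet_lineKet]
  have hstep := dirStep_p₁_eq_of_dirCongr n D p₁ Q b b' hbb'
  have hshift : ∀ j j' : ZP p₁ Q, F (j + p) (j' + p) = ζ * F j j' := by
    intro j j'
    simp only [hF]
    rw [ptB_add_p₁ n D p₁ Q b v' j, ptB_add_p₁ n D p₁ Q b' w' j', hstep]
    by_cases hc : ptB n D p₁ Q b v' j = ptB n D p₁ Q b' w' j'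
    · rw [if_pos (by rw [hc]), if_pos hc]
      -- the phase gained by the shift, on the coincidence set
      have h0 := congr_fun hc 0
      simp only [ptB, hb, hb'] at h0
      have e0 : ((v' 0 : ℤ) : ZN D p₁ Q) = ((w' 0 : ℤ) : ZN D p₁ Q)
          + ((2 * ((D : ℕ) : ℤ) ^ 2 * (((j.val : ℕ) : ℤ) - ((j'.val : ℕ) : ℤ)) : ℤ) : ZN D p₁ Q) := by
        push_cast at h0 ⊢
        linear_combination h0
      have hX : ((2 * D * D : ℕ) : ZQ Q) * ((((j.val : ℕ) : ℤ) - ((j'.val : ℕ) : ℤ) : ℤ) : ZQ Q)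
          = Δ := by
        rw [hΔ, e0, map_add, add_sub_cancel_left, toDatum_intCast]
        push_cast; ring
      have hX' : ((((j.val : ℕ) : ℤ) - ((j'.val : ℕ) : ℤ) : ℤ) : ZQ Q)
          = ((u2⁻¹ : (ZQ Q)ˣ) : ZQ Q) * Δ := by
        rw [← hX, ← hu2, Units.inv_mul_cancel_left]
      have hphase : (ZMod.stdAddChar (2 * p * (j - j')) : ℂ) = ζ := by
        rw [hζ, ← hX', show 2 * p * (j - j') = p * (2 * (j - j')) by ring, hp,
          stdAddChar_p₁_mul]
        congr 2
        have hj : toQ p₁ Q j = (((j.val : ℕ) : ℤ) : ZQ Q) := by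
          conv_lhs => rw [← ZMod.natCast_zmod_val j]
          rw [map_natCast, Int.cast_natCast]
        have hj' : toQ p₁ Q j' = (((j'.val : ℕ) : ℤ) : ZQ Q) := by
          conv_lhs => rw [← ZMod.natCast_zmod_val j']
          rw [map_natCast, Int.cast_natCast]
        rw [map_mul, map_sub, hj, hj', map_ofNat, Int.cast_sub]
      rw [← hphase, ← AddChar.map_neg_eq_conj, ← AddChar.map_neg_eq_conj, ← AddChar.map_add_eq_mul,
        ← AddChar.map_add_eq_mul, ← AddChar.map_add_eq_mul]
      congr 1
      ring
    · rw [if_neg (fun h => hc (add_right_cancel h)), if_neg hc, mul_zero]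
  have hinv : ∑ j, ∑ j', F j j' = ζ * ∑ j, ∑ j', F j j' := by
    calc ∑ j, ∑ j', F j j' = ∑ j, ∑ j', F (j + p) (j' + p) := by
          rw [← Equiv.sum_comp (Equiv.addRight p)]
          refine Finset.sum_congr rfl fun j _ => ?_
          rw [← Equiv.sum_comp (Equiv.addRight p)]
          rfl
      _ = ∑ j, ∑ j', ζ * F j j' := by simp_rw [hshift]
      _ = ζ * ∑ j, ∑ j', F j j' := by simp_rw [Finset.mul_sum]
  have hzero : (1 - ζ) * ∑ j, ∑ j', F j j' = 0 := by linear_combination hinv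
  rw [hS]
  exact (mul_eq_zero.1 hzero).resolve_left (sub_ne_zero.2 (Ne.symm hζ1))

/-- **The chirp family is complete**: its span projector is the identity. [folklore] -/
theorem spanProj_chirpKet_eq_one (hP : Odd ((p₁ * Q : ℕ+) : ℕ)) (hb : b 0 = -1) :
    spanProj (chirpKet n D p₁ Q b) (((p₁ * Q : ℕ+) : ℕ) : ℝ) = 1 :=
  eq_of_mulVec_chirpKet_eq n D p₁ Q b hP fun u => by
    rw [spanProj_mulVec_self (P_pos_real p₁ Q) (chirpKet_orth' n D p₁ Q b hP hb), Matrix.one_mulVec]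

/-- The effects of the offset reader are the rank-one projectors `P⁻¹|φ_{b,u}⟩⟨φ_{b,u}|` (no blind term:
the chirp family is complete). [cite: NielsenChuang2010, §2.2.6 p. 90] -/
theorem offsetReader_effect (hP : Odd ((p₁ * Q : ℕ+) : ℕ)) (hb : b 0 = -1)
    (u : Fin (n + 1) → ZN D p₁ Q) :
    (offsetReader n D p₁ Q b hP hb).effect u
      = ((((p₁ * Q : ℕ+) : ℕ) : ℂ))⁻¹
          • vecMulVec (chirpKet n D p₁ Q b u) (star (chirpKet n D p₁ Q b u)) := by
  unfold offsetReader POVM.ofOrthogonal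
  dsimp only
  rw [spanProj_chirpKet_eq_one n D p₁ Q b hP hb, sub_self, smul_zero, add_zero, Complex.ofReal_inv,
    Complex.ofReal_natCast]

/-- The offset reader's outcome distribution on any state: `P⁻¹|⟨φ_{b,u}|ψ⟩|²`.
[cite: NielsenChuang2010, §2.2.6 p. 90] -/
theorem offsetReader_weight (hP : Odd ((p₁ * Q : ℕ+) : ℕ)) (hb : b 0 = -1)
    (ψ : Ket (n + 1) ((D * D * (p₁ * Q) : ℕ+) : ℕ)) (u : Fin (n + 1) → ZN D p₁ Q) :
    (offsetReader n D p₁ Q b hP hb).weight ψ u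
      = ((((p₁ * Q : ℕ+) : ℕ) : ℂ))⁻¹
          * ((starRingEnd ℂ) (star (chirpKet n D p₁ Q b u) ⬝ᵥ ψ)
              * (star (chirpKet n D p₁ Q b u) ⬝ᵥ ψ)) := by
  unfold POVM.weight
  rw [offsetReader_effect, Matrix.smul_mulVec, vecMulVec_star_mulVec, dotProduct_smul, dotProduct_smul,
    star_dotProduct, smul_eq_mul, smul_eq_mul, Complex.star_def, Complex.conj_conj]
  ring

/-- **Within a direction class mod `Q` the datum reader of `b` is datum-certain on every line ket of
`b′`.** [cite: ChenQuantumLattice2024, §3.5.9 pp. 35–37] -/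
theorem datumReader_certain_of_dirCongr (hP : Odd ((p₁ * Q : ℕ+) : ℕ)) (hb : b 0 = -1)
    (b' : Fin (n + 1) → ℤ) (hb' : b' 0 = -1) (hunit : IsUnit ((2 * D * D * p₁ : ℕ) : ZQ Q))
    (hbb' : ∀ k, ((b k : ℤ) : ZQ Q) = ((b' k : ℤ) : ZQ Q)) (w' : Fin (n + 1) → ℤ) :
    (datumReader n D p₁ Q b hP hb).Certain (phi8bKet n D p₁ Q b' w')
      (toDatum D p₁ Q ((w' 0 : ℤ) : ZN D p₁ Q)) := by
  classical
  have hzero : ∀ a, a ≠ toDatum D p₁ Q ((w' 0 : ℤ) : ZN D p₁ Q) →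
      (datumReader n D p₁ Q b hP hb).weight (phi8bKet n D p₁ Q b' w') a = 0 := by
    intro a ha
    have hw := POVM.map_weight (offsetReader n D p₁ Q b hP hb) (fun u => toDatum D p₁ Q (u 0))
      (phi8bKet n D p₁ Q b' w') a
    refine hw.trans (Finset.sum_eq_zero fun u hu => ?_)
    have hu' : toDatum D p₁ Q (u 0) = a := (Finset.mem_filter.1 hu).2
    have horth : star (chirpKet n D p₁ Q b u) ⬝ᵥ phi8bKet n D p₁ Q b' w' = 0 := by
      refine dotProduct_phi8bKet_eq_zero_of_dirCongr n D p₁ Q b hP hb b' hb' hunit hbb' ?_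
      rw [intCast_liftV, hu']
      exact ha
    rw [offsetReader_weight, horth, mul_zero, mul_zero]
  have hsum := (datumReader n D p₁ Q b hP hb).sum_weight (phi8bKet n D p₁ Q b' w')
  rw [← Finset.add_sum_erase _ _ (Finset.mem_univ (toDatum D p₁ Q ((w' 0 : ℤ) : ZN D p₁ Q))),
    Finset.sum_eq_zero (fun a ha => hzero a (Finset.mem_erase.1 ha).1), add_zero] at hsum
  exact hsum

/-- **THE DIRECTION CLASS A CERTAIN READER NEEDS (T18).**  For heads `−1` and `2D²p₁` a unit mod `Q`:
the datum reader of `b` outputs the datum with certainty on every line ket of `b′` IF AND ONLY IF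
`b ≡ b′ (mod Q)` coordinatewise. [cite: ChenQuantumLattice2024, §3.5.9 pp. 35–37] -/
theorem datumReader_certain_iff (hP : Odd ((p₁ * Q : ℕ+) : ℕ)) (hb : b 0 = -1)
    (b' : Fin (n + 1) → ℤ) (hb' : b' 0 = -1) (hunit : IsUnit ((2 * D * D * p₁ : ℕ) : ZQ Q)) :
    (∀ w' : Fin (n + 1) → ℤ, (datumReader n D p₁ Q b hP hb).Certain (phi8bKet n D p₁ Q b' w')
        (toDatum D p₁ Q ((w' 0 : ℤ) : ZN D p₁ Q)))
      ↔ ∀ k, ((b k : ℤ) : ZQ Q) = ((b' k : ℤ) : ZQ Q) := by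
  refine ⟨fun h => ?_,
    fun hbb' w' => datumReader_certain_of_dirCongr n D p₁ Q b hP hb b' hb' hunit hbb' w'⟩
  by_contra hne
  push Not at hne
  obtain ⟨i, hi⟩ := hne
  exact not_certain_pair n D p₁ Q b hP hb b' hb' hunit hi (datumReader n D p₁ Q b hP hb) 0
    ⟨datumReader_certain n D p₁ Q b hP hb 0, h _⟩

end ChirpBasis

end Literature.Computability.Cryptography.Chen2024

/-! ### 5. For admissible shapes -/

namespace Literature.Computability.Cryptography.Chen2024.Shape

open Literature.Computability.Cryptography.Chen2024

variable (S : Shape)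

/-- `2D²p₁` is a unit mod `Q` for admissible shapes (`Q` odd, coprime to `D` and `p₁`).
[cite: ChenQuantumLattice2024, §3.5 p. 23] -/
theorem Admissible.isUnit_twoDDp₁_modQ {S : Shape} (h : S.Admissible) :
    IsUnit ((2 * S.D * S.D * S.p₁ : ℕ) : ZQ S.Q) := by
  rw [ZMod.isUnit_iff_coprime]
  exact Nat.Coprime.mul_left
    (Nat.Coprime.mul_left (Nat.Coprime.mul_left (Nat.coprime_two_left.2 h.odd_Q) h.cop_DQ) h.cop_DQ)
    h.cop_pQ

/-- **T18 for admissible shapes (census O1, row G7).**  An observer who knows `S.b` reads the offset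
`S.v′ mod N` of `|φ8.b⟩` — hence its datum and its Step-8 value — with certainty.
[cite: ChenQuantumLattice2024, §3.5.9 pp. 35–37] -/
theorem offsetReader_certain (h : S.Admissible) :
    (Chen2024.offsetReader S.n S.D S.p₁ S.Q S.b h.odd_P h.b_head).Certain S.phi8b
      (fun i => ((S.v' i : ℤ) : ZN S.D S.p₁ S.Q)) := by
  rw [phi8b_eq_phi8bKet]
  exact Chen2024.offsetReader_certain S.n S.D S.p₁ S.Q S.b h.odd_P h.b_head S.v'

/-- **T18 for admissible shapes (row G7: what the observer must know).**  The datum reader of `S.b`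
is datum-certain on all line kets of another head-`(−1)` direction `b′` iff `b′ ≡ S.b (mod Q)`.
[cite: ChenQuantumLattice2024, §3.5.9 pp. 35–37] -/
theorem datumReader_certain_iff (h : S.Admissible) {b' : Fin (S.n + 1) → ℤ} (hb' : b' 0 = -1) :
    (∀ w' : Fin (S.n + 1) → ℤ,
        (Chen2024.datumReader S.n S.D S.p₁ S.Q S.b h.odd_P h.b_head).Certain
          (phi8bKet S.n S.D S.p₁ S.Q b' w') (toDatum S.D S.p₁ S.Q ((w' 0 : ℤ) : ZN S.D S.p₁ S.Q)))
      ↔ ∀ k, ((S.b k : ℤ) : ZQ S.Q) = ((b' k : ℤ) : ZQ S.Q) :=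
  Chen2024.datumReader_certain_iff S.n S.D S.p₁ S.Q S.b h.odd_P h.b_head b' hb'
    h.isUnit_twoDDp₁_modQ

/-- **T18 for admissible shapes (row G7: no class-crossing certain reader).**  If `b′ ≢ S.b (mod Q)`
at some coordinate, no measurement at all is datum-certain on the line kets of both directions.
[cite: ChenQuantumLattice2024, §3.5.9 pp. 35–37; NielsenChuang2010, Box 2.3 p. 87] -/
theorem not_certain_both (h : S.Admissible) {b' : Fin (S.n + 1) → ℤ} (hb' : b' 0 = -1)
    {i : Fin (S.n + 1)} (hi : ((S.b i : ℤ) : ZQ S.Q) ≠ ((b' i : ℤ) : ZQ S.Q))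
    (E : POVM (Fin (S.n + 1) → ZN S.D S.p₁ S.Q) (ZQ S.Q)) :
    ¬ ((∀ v' : Fin (S.n + 1) → ℤ,
          E.Certain (phi8bKet S.n S.D S.p₁ S.Q S.b v') (toDatum S.D S.p₁ S.Q ((v' 0 : ℤ) : ZN S.D S.p₁ S.Q)))
        ∧ ∀ w' : Fin (S.n + 1) → ℤ,
          E.Certain (phi8bKet S.n S.D S.p₁ S.Q b' w') (toDatum S.D S.p₁ S.Q ((w' 0 : ℤ) : ZN S.D S.p₁ S.Q))) :=
  Chen2024.not_certain_both S.n S.D S.p₁ S.Q S.b h.odd_P h.b_head b' hb' h.isUnit_twoDDp₁_modQ hi E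

end Literature.Computability.Cryptography.Chen2024.Shape
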